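import Mathlib
import Summits.AtomisticToContinuum.HydrodynamicLimit.Theorems.OneSphereInfluenceStaticScoreResponseRealAnalysis
import Literature.MathematicalPhysics.KineticTheory.HardSphereEulerProofs
import HarnessLib

/-!
# `StaticScoreResponse` (support item stmt-AtomisticToContinuum-12269): limits of means

Elementary convergence tools for the assembly of `StaticScoreResponse`:

* `tendsto_integral_of_tendsto_measure_sub` — uniformly bounded observables converging in
  probability to a constant converge in mean (probability measures);
* `tendsto_posGibbsMeasure_of_hydroFields` / `tendsto_mean_of_hydroFields` — the route hypothesis
  (convergence in probability of the hydrodynamic fields at time `0` under the local Gibbs laws,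
  `TendstoHydroFieldsAt … 0`) pins the configurational means: for every continuous `g`,
  `E_{posGibbsMeasure (a₁) ε_N (N+1)}[(N+1)⁻¹ ∑ g(xᵢ)] → ∫ g ρ₁` (flow at time `0` is the identity
  a.e., position marginal, bounded convergence);
* `tendstoUniformlyOn_of_equicontinuous` — pointwise convergence of an equicontinuous sequence on
  a compact set is uniform, with continuous limit.

Folklore; no definitions, no named facts.
-/

noncomputable section

namespace Summit.AtomisticToContinuum.HydrodynamicLimit.Theorems

open MeasureTheory Metric Set Filter Topology Finset
  Literature.Analysis.FluidPDE Literature.MathematicalPhysics.KineticTheory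
open scoped ENNReal

/-! ### Bounded convergence in probability -/

/-- **Bounded convergence.** If `|f_N| ≤ B`, the `μ_N` are probability measures and
`μ_N(δ < |f_N - c|) → 0` for every `δ > 0`, then `∫ f_N dμ_N → c`. [folklore] -/
theorem tendsto_integral_of_tendsto_measure_sub {X : ℕ → Type*} [∀ N, MeasurableSpace (X N)]
    {μ : (N : ℕ) → Measure (X N)} [∀ N, IsProbabilityMeasure (μ N)] {f : (N : ℕ) → X N → ℝ}
    (hfm : ∀ N, Measurable (f N)) {B : ℝ} (hfB : ∀ N x, |f N x| ≤ B) {c : ℝ}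
    (h : ∀ δ > (0 : ℝ), Tendsto (fun N => μ N {x | δ < |f N x - c|}) atTop (𝓝 0)) :
    Tendsto (fun N => ∫ x, f N x ∂μ N) atTop (𝓝 c) := by
  rw [Metric.tendsto_atTop]
  intro ε hε
  set δ : ℝ := ε / 3 with hδdef
  have hδ : 0 < δ := by positivity
  set L : ℝ := |B| + |c| + 1 with hLdef
  have hL0 : 0 < L := by positivity
  have hev : ∀ᶠ N in atTop, μ N {x | δ < |f N x - c|} < ENNReal.ofReal (δ / L) :=
    (h δ hδ).eventually (gt_mem_nhds (ENNReal.ofReal_pos.2 (div_pos hδ hL0)))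
  obtain ⟨N₀, hN₀⟩ := eventually_atTop.1 hev
  refine ⟨N₀, fun N hN => ?_⟩
  set A : Set (X N) := {x | δ < |f N x - c|} with hAdef
  have hA : μ N A < ENNReal.ofReal (δ / L) := hN₀ N hN
  have hAm : MeasurableSet A := measurableSet_lt measurable_const ((hfm N).sub measurable_const).abs
  -- pointwise bound
  have hpt : ∀ x, |f N x - c| ≤ δ + L * A.indicator (fun _ => (1 : ℝ)) x := by
    intro x
    by_cases hx : x ∈ A
    · rw [Set.indicator_of_mem hx, mul_one]
      have : |f N x - c| ≤ |B| + |c| := (abs_sub _ _).trans (add_le_add ((hfB N x).trans (le_abs_self B)) le_rfl)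
      linarith
    · rw [Set.indicator_of_notMem hx, mul_zero, add_zero]
      exact not_lt.1 hx
  -- integrate
  have hfi : Integrable (f N) (μ N) := Integrable.mono' (integrable_const |B|) (hfm N).aestronglyMeasurable
    (ae_of_all _ fun x => by rw [Real.norm_eq_abs]; exact (hfB N x).trans (le_abs_self B))
  have hfc : Integrable (fun x => f N x - c) (μ N) := hfi.sub (integrable_const c)
  have hind : Integrable (fun x => A.indicator (fun _ => (1 : ℝ)) x) (μ N) := (integrable_const (1 : ℝ)).indicator hAm
  have hμA : (μ N A).toReal < δ / L := ENNReal.toReal_lt_of_lt_ofReal hA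
  rw [Real.dist_eq]
  calc |(∫ x, f N x ∂μ N) - c| = |∫ x, (f N x - c) ∂μ N| := by
        rw [integral_sub hfi (integrable_const c), integral_const]
        simp
    _ ≤ ∫ x, |f N x - c| ∂μ N := abs_integral_le_integral_abs
    _ ≤ ∫ x, (δ + L * A.indicator (fun _ => (1 : ℝ)) x) ∂μ N :=
        integral_mono hfc.abs ((integrable_const δ).add (hind.const_mul L)) hpt
    _ = δ + L * (μ N A).toReal := by
        rw [integral_add (integrable_const δ) (hind.const_mul L), integral_const, integral_const_mul,
          integral_indicator_const _ hAm]
        simp [measureReal_def]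
    _ < δ + L * (δ / L) := by gcongr
    _ = δ + δ := by rw [mul_div_cancel₀ _ hL0.ne']
    _ < ε := by rw [hδdef]; linarith

/-- `|n⁻¹ ∑ G(xᵢ)| ≤ η` for `|G| ≤ η`. [folklore] -/
theorem abs_avg_sum_le_of_le {G : T3 → ℝ} {η : ℝ} (hη : 0 ≤ η) (hG : ∀ x, |G x| ≤ η) {n : ℕ} (x : Fin n → T3) :
    |(n : ℝ)⁻¹ * ∑ i, G (x i)| ≤ η := by
  rcases Nat.eq_zero_or_pos n with hn | hn
  · subst hn; simpa using hη
  have hn' : (0 : ℝ) < n := by exact_mod_cast hn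
  rw [abs_mul, abs_of_pos (inv_pos.2 hn')]
  calc (n : ℝ)⁻¹ * |∑ i, G (x i)| ≤ (n : ℝ)⁻¹ * (n * η) := by
        refine mul_le_mul_of_nonneg_left ?_ (inv_nonneg.2 hn'.le)
        calc |∑ i, G (x i)| ≤ ∑ i, |G (x i)| := Finset.abs_sum_le_sum_abs _ _
          _ ≤ ∑ _i : Fin n, η := Finset.sum_le_sum fun i _ => hG _
          _ = n * η := by simp
    _ = η := by field_simp

/-! ### From the hydrodynamic-field hypothesis to configurational means -/

variable {a₁ θ₁ ρ₁ : T3 → ℝ} {u₁ : T3 → V3} {σ : ℝ}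
  {Φ : (N : ℕ) → HardSphereFlow (Torus.geometry (Fin 3)) (hsDiameter σ N) (N + 1)}
  {uL : ℝ → T3 → V3} {θL : ℝ → T3 → ℝ}

/-- **Density events under the configurational Gibbs measure** are controlled by the route
hypothesis: if the hydrodynamic fields at time `0` converge in probability under the local Gibbs
laws (density limit `ρ₁`), then for every continuous `g` and `δ > 0`,
`posGibbsMeasure a₁ ε_N (N+1) {δ < |(N+1)⁻¹ ∑ g(xᵢ) - ∫ g ρ₁|} → 0`. [folklore] -/
theorem tendsto_posGibbsMeasure_of_hydroFields (ha : Continuous a₁) (hθ : Continuous θ₁) (hu : Continuous u₁)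
    (ha0 : ∀ x, 0 ≤ a₁ x) (hθ0 : ∀ x, 0 < θ₁ x)
    (hT : TendstoHydroFieldsAt (fun N => localGibbsLaw σ a₁ u₁ θ₁ N (Φ N)) Φ (fun _ => ρ₁) uL θL 0)
    {g : T3 → ℝ} (hg : Continuous g) {δ : ℝ} (hδ : 0 < δ) :
    Tendsto (fun N : ℕ => posGibbsMeasure a₁ (hsDiameter σ N) (N + 1)
      {x | δ < |((N + 1 : ℕ) : ℝ)⁻¹ * ∑ i, g (x i) - ∫ y, g y * ρ₁ y|}) atTop (𝓝 0) := by
  have h := (hT g hg δ hδ).1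
  refine h.congr fun N => ?_
  have hS : MeasurableSet {x : Fin (N + 1) → T3 |
      δ < |((N + 1 : ℕ) : ℝ)⁻¹ * ∑ i, g (x i) - ∫ y, g y * ρ₁ y|} :=
    measurableSet_lt measurable_const ((measurable_const.mul (Finset.measurable_sum _
      fun i _ => hg.measurable.comp (measurable_pi_apply i))).sub measurable_const).abs
  calc localGibbsLaw σ a₁ u₁ θ₁ N (Φ N) {z | δ < |empiricalDensityField ((Φ N).flow 0 z) g - ∫ y, g y * ρ₁ y|}
      = localGibbsLaw σ a₁ u₁ θ₁ N (Φ N) ((Φ N).flow 0 ⁻¹'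
          {w | δ < |empiricalDensityField w g - ∫ y, g y * ρ₁ y|}) := rfl
    _ = localGibbsMeasure σ a₁ u₁ θ₁ N {w | δ < |empiricalDensityField w g - ∫ y, g y * ρ₁ y|} :=
        localGibbsLaw_preimage_flow_zero σ a₁ u₁ θ₁ N (Φ N) _
    _ = localGibbsMeasure σ a₁ u₁ θ₁ N
          {w | δ < |((N + 1 : ℕ) : ℝ)⁻¹ * ∑ i, g (w i).1 - ∫ y, g y * ρ₁ y|} := by
        simp only [empiricalDensityField_eq_sum]
    _ = posGibbsMeasure a₁ (hsDiameter σ N) (N + 1)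
          {x | δ < |((N + 1 : ℕ) : ℝ)⁻¹ * ∑ i, g (x i) - ∫ y, g y * ρ₁ y|} :=
        localGibbsMeasure_preimage_pos ha hθ hu ha0 hθ0 σ N hS

/-- **Configurational means are pinned by the route hypothesis**: under `TendstoHydroFieldsAt … 0`
with density limit `ρ₁`, `E_{posGibbsMeasure a₁ ε_N (N+1)}[(N+1)⁻¹ ∑ g(xᵢ)] → ∫ g ρ₁` for every
continuous `g` (`a₁ > 0`, `σ ≤ 1/2`). [folklore] -/
theorem tendsto_mean_of_hydroFields (ha : Continuous a₁) (hθ : Continuous θ₁) (hu : Continuous u₁)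
    (ha0 : ∀ x, 0 < a₁ x) (hθ0 : ∀ x, 0 < θ₁ x) (hσ2 : σ ≤ 1 / 2)
    (hT : TendstoHydroFieldsAt (fun N => localGibbsLaw σ a₁ u₁ θ₁ N (Φ N)) Φ (fun _ => ρ₁) uL θL 0)
    {g : T3 → ℝ} (hg : Continuous g) :
    Tendsto (fun N : ℕ => ∫ x, ((N + 1 : ℕ) : ℝ)⁻¹ * ∑ i, g (x i) ∂posGibbsMeasure a₁ (hsDiameter σ N) (N + 1))
      atTop (𝓝 (∫ y, g y * ρ₁ y)) := by
  obtain ⟨C, hC0, hC⟩ := exists_forall_abs_le_of_continuous hg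
  haveI : ∀ N : ℕ, IsProbabilityMeasure (posGibbsMeasure a₁ (hsDiameter σ N) (N + 1)) :=
    fun N => isProbabilityMeasure_posGibbsMeasure ha ha0 hσ2 N
  refine tendsto_integral_of_tendsto_measure_sub (X := fun N : ℕ => Fin (N + 1) → T3)
    (μ := fun N => posGibbsMeasure a₁ (hsDiameter σ N) (N + 1))
    (f := fun N x => ((N + 1 : ℕ) : ℝ)⁻¹ * ∑ i, g (x i))
    (fun N => (Finset.measurable_sum _ fun i _ => hg.measurable.comp (measurable_pi_apply i)).const_mul _) (B := C)
    (fun N x => abs_avg_sum_le_of_le hC0 hC x) fun δ hδ => ?_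
  exact tendsto_posGibbsMeasure_of_hydroFields ha hθ hu (fun x => (ha0 x).le) hθ0 hT hg hδ

/-! ### Uniform convergence from equicontinuity -/

/-- Each member of an equicontinuous family is continuous on the set. [folklore] -/
theorem continuousOn_of_equicontinuous {X : Type*} [PseudoMetricSpace X] {s : Set X} {F : ℕ → X → ℝ}
    (hequi : ∀ ε > (0 : ℝ), ∃ ρ > (0 : ℝ), ∀ n, ∀ x ∈ s, ∀ y ∈ s, dist x y < ρ → dist (F n x) (F n y) < ε) (n : ℕ) :
    ContinuousOn (F n) s := by
  rw [Metric.continuousOn_iff]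
  intro x hx ε hε
  obtain ⟨ρ, hρ, h⟩ := hequi ε hε
  exact ⟨ρ, hρ, fun y hy hxy => h n y hy x hx hxy⟩

/-- Uniform convergence is preserved under multiplication by a constant. [folklore] -/
theorem tendstoUniformlyOn_const_mul {X : Type*} {s : Set X} {F : ℕ → X → ℝ} {f : X → ℝ}
    (h : TendstoUniformlyOn F f atTop s) (c : ℝ) :
    TendstoUniformlyOn (fun n x => c * F n x) (fun x => c * f x) atTop s := by
  rw [Metric.tendstoUniformlyOn_iff] at h ⊢
  intro ε hε
  have hc : 0 < |c| + 1 := by positivity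
  filter_upwards [h (ε / (|c| + 1)) (div_pos hε hc)] with n hn x hx
  have h1 := hn x hx
  rw [Real.dist_eq] at h1 ⊢
  rw [← mul_sub, abs_mul]
  calc |c| * |f x - F n x| ≤ (|c| + 1) * |f x - F n x| := by nlinarith [abs_nonneg c, abs_nonneg (f x - F n x)]
    _ < (|c| + 1) * (ε / (|c| + 1)) := mul_lt_mul_of_pos_left h1 hc
    _ = ε := mul_div_cancel₀ _ hc.ne'

/-- **Pointwise convergence of an equicontinuous sequence on a compact set is uniform**, and the
limit is continuous. [folklore] -/
theorem tendstoUniformlyOn_of_equicontinuous {X : Type*} [PseudoMetricSpace X] {s : Set X} (hs : IsCompact s)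
    {F : ℕ → X → ℝ} {f : X → ℝ}
    (hequi : ∀ ε > (0 : ℝ), ∃ ρ > (0 : ℝ), ∀ n, ∀ x ∈ s, ∀ y ∈ s, dist x y < ρ → dist (F n x) (F n y) < ε)
    (hpt : ∀ x ∈ s, Tendsto (fun n => F n x) atTop (𝓝 (f x))) :
    TendstoUniformlyOn F f atTop s ∧ ContinuousOn f s := by
  have hC := uniformCauchySeqOn_of_equicontinuous hs hequi fun x hx => (hpt x hx).cauchySeq
  have hU : TendstoUniformlyOn F f atTop s := hC.tendstoUniformlyOn_of_tendsto hpt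
  exact ⟨hU, hU.continuousOn (Eventually.of_forall fun n => continuousOn_of_equicontinuous hequi n).frequently⟩

end Summit.AtomisticToContinuum.HydrodynamicLimit.Theorems

end
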